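import Literature.Analysis.FluidPDE.PeriodicLerayCompactness
import Literature.Analysis.FluidPDE.WeakGradientWeakLimitL2
import Literature.Analysis.FluidPDE.SuitableWeakExhaustion
import Literature.Analysis.FunctionSpaces.DiagonalSubsequence
import Literature.Analysis.FunctionSpaces.LpInterpolationConvergence
import HarnessLib

/-!
# [BT1] proof of Theorem 2.4, the limit `ε → 0`, IV: the weak spatial gradient of the limit
  velocity and the weak `L²` convergence of the gradients on every time slab

Analysis/FluidPDE proof file (theorems only, no new definitions, no named facts), fourth part
of the discharge of the named fact `Literature.Analysis.FluidPDE.bradshawTsai2017_thm_2_4_limit`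
(`PeriodicLerayExistence.lean`; Bradshaw–Tsai, Ann. Henri Poincaré 18 (2017) =
arXiv:1510.07504 [BT1], §2, proof of Thm 2.4): "`U_{ε_k} → U` weakly in `L²(0,T;X)`" — the
gradients `∇U_{ε_k}` converge weakly in `L²` and the limit `U` lies in `L²(0,T;H¹)`.

Given the approximants `U_k` with weak spatial gradients `G_k` on `ℝ × ℝ³`
(`∫∫_{(0,T)×ℝ³} |G_k|² ≤ C`, `T`-periodic `U_k`) and a subsequence `U_{φ k} → u` in `L²` of every
cylinder `Q_n = (−n−1, n+1) × B(0, n+1)` (the output of `PeriodicLerayLimitVelocity`), this file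
produces a further subsequence `κ` and **one** weak spatial gradient `G` of `u` on all of
`ℝ × ℝ³` with `∫∫_{(−m−1,m+1)×ℝ³} |G|² ≤ 2(⌈(2m+2)/T⌉₊ + 1) C` and
`∫_{Ω_m} ⟪G_{φ(κ k)} a, h⟫ → ∫_{Ω_m} ⟪G a, h⟫` for every slab `Ω_m = (−m−1, m+1) × ℝ³`, every
direction `a` and every `h ∈ L²(Ω_m; ℝ³)`:
the tree's extraction theorem `exists_hasWeakSpatialGradientOn_of_weakGradient_approx_L2`
(weak compactness in `L²(Ω_m; E^{3×3})`, Brezis Thm. 3.18) on each slab, Cantor's diagonal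
procedure (`FunctionSpaces.exists_strictMono_forall_of_extraction`) and the gluing of weak
gradients along an exhaustion (`exists_hasWeakSpatialGradientOn_of_exhaustion`, weak gradients
being a.e. unique).

* `tendsto_eLpNorm_one_of_isCompact` — `L²` convergence on the cylinders gives `L¹` convergence
  on every compact set;
* `exists_gradient_limit` — the extraction.

## References

* Z. Bradshaw, T.-P. Tsai, Ann. Henri Poincaré 18 (2017) 1095–1119 = arXiv:1510.07504, §2,
  proof of Thm 2.4 ("`U_{ε_k} → U` weakly in `L²(0,T;X)`") [BradshawTsai2017AHP].
* H. Brezis, *Functional Analysis, Sobolev Spaces and PDE* (2011), Thm. 3.18 [Brezis2011].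
* L. C. Evans, *Partial Differential Equations* (2010), §5.2.1 [Evans2010].
-/

noncomputable section

open MeasureTheory TopologicalSpace Set Function Filter Metric Bornology
open scoped NNReal ENNReal Topology InnerProductSpace RealInnerProductSpace

namespace Literature.Analysis.FluidPDE

namespace BradshawTsai2017

/-! ### From `L²` on the cylinders to `L¹` on compact sets -/

section Compact

/-- Every compact subset of `ℝ × ℝ³` lies in one of the cylinders
`Q_n = (−n−1, n+1) × B(0, n+1)`. [folklore] -/
theorem exists_subset_cylinder_of_isCompact {K : Set (ℝ × EuclideanSpace ℝ (Fin 3))} (hK : IsCompact K) :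
    ∃ n : ℕ, K ⊆ Ioo (-((n : ℝ) + 1)) ((n : ℝ) + 1) ×ˢ ball (0 : EuclideanSpace ℝ (Fin 3)) (n + 1) := by
  obtain ⟨r, hr⟩ := hK.isBounded.subset_closedBall (0 : ℝ × EuclideanSpace ℝ (Fin 3))
  refine ⟨⌈|r|⌉₊, fun z hz => ?_⟩
  have h1 : ‖z‖ ≤ r := by simpa using hr hz
  have h2 : |z.1| ≤ r := (norm_fst_le z).trans h1
  have h3 : ‖z.2‖ ≤ r := (norm_snd_le z).trans h1
  have h4 : r ≤ ⌈|r|⌉₊ := (le_abs_self r).trans (Nat.le_ceil _)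
  refine ⟨⟨?_, ?_⟩, ?_⟩
  · linarith [neg_abs_le z.1]
  · linarith [le_abs_self z.1]
  · rw [mem_ball_zero_iff]; linarith

/-- **`L²` convergence on the cylinders gives `L¹` convergence on compact sets**
(Cauchy–Schwarz on a set of finite measure). [folklore] -/
theorem tendsto_eLpNorm_one_of_isCompact {V : ℕ → ℝ → EuclideanSpace ℝ (Fin 3) → EuclideanSpace ℝ (Fin 3)}
    {u : ℝ → EuclideanSpace ℝ (Fin 3) → EuclideanSpace ℝ (Fin 3)}
    (hVm : ∀ k, AEStronglyMeasurable (uncurry (V k)) (volume : Measure (ℝ × EuclideanSpace ℝ (Fin 3))))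
    (hum : AEStronglyMeasurable (uncurry u) (volume : Measure (ℝ × EuclideanSpace ℝ (Fin 3))))
    (hconv : ∀ n : ℕ, Tendsto (fun k => ∫⁻ z in Ioo (-((n : ℝ) + 1)) ((n : ℝ) + 1) ×ˢ
        ball (0 : EuclideanSpace ℝ (Fin 3)) (n + 1), ‖V k z.1 z.2 - u z.1 z.2‖ₑ ^ 2) atTop (𝓝 0))
    {K : Set (ℝ × EuclideanSpace ℝ (Fin 3))} (hK : IsCompact K) :
    Tendsto (fun k => eLpNorm (fun z => uncurry (V k) z - uncurry u z) 1 (volume.restrict K))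
      atTop (𝓝 0) := by
  obtain ⟨n, hKQ⟩ := exists_subset_cylinder_of_isCompact hK
  set Q : Set (ℝ × EuclideanSpace ℝ (Fin 3)) :=
    Ioo (-((n : ℝ) + 1)) ((n : ℝ) + 1) ×ˢ ball (0 : EuclideanSpace ℝ (Fin 3)) (n + 1) with hQ
  have hKfin : volume K ≠ ∞ := hK.measure_lt_top.ne
  have h2 : Tendsto (fun k => eLpNorm (uncurry (V k) - uncurry u) 2 (volume.restrict Q)) atTop (𝓝 0) :=
    FunctionSpaces.tendsto_eLpNorm_two_of_tendsto_lintegral_sq (f := fun k => uncurry (V k))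
      (g := uncurry u) (hconv n)
  have hbound : ∀ k, eLpNorm (fun z => uncurry (V k) z - uncurry u z) 1 (volume.restrict K) ≤
      volume K ^ (1 / 2 : ℝ) * eLpNorm (uncurry (V k) - uncurry u) 2 (volume.restrict Q) := by
    intro k
    have hm : AEStronglyMeasurable (uncurry (V k) - uncurry u) (volume.restrict K) :=
      ((hVm k).sub hum).restrict
    calc eLpNorm (fun z => uncurry (V k) z - uncurry u z) 1 (volume.restrict K)
        = ∫⁻ z in K, ‖(uncurry (V k) - uncurry u) z‖ₑ := by
          rw [eLpNorm_one_eq_lintegral_enorm]; rfl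
      _ ≤ (volume.restrict K) univ ^ (1 / 2 : ℝ) * eLpNorm (uncurry (V k) - uncurry u) 2 (volume.restrict K) :=
          lintegral_enorm_le_measure_univ_mul_eLpNorm_two hm
      _ ≤ volume K ^ (1 / 2 : ℝ) * eLpNorm (uncurry (V k) - uncurry u) 2 (volume.restrict Q) := by
          rw [Measure.restrict_apply_univ]
          exact mul_le_mul' le_rfl (eLpNorm_mono_measure _ (Measure.restrict_mono hKQ le_rfl))
  have hlim : Tendsto (fun k => volume K ^ (1 / 2 : ℝ) *
      eLpNorm (uncurry (V k) - uncurry u) 2 (volume.restrict Q)) atTop (𝓝 0) := by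
    have h := ENNReal.Tendsto.const_mul h2 (a := volume K ^ (1 / 2 : ℝ))
      (Or.inr (ENNReal.rpow_ne_top_of_nonneg (by norm_num) hKfin))
    rwa [mul_zero] at h
  exact tendsto_of_tendsto_of_tendsto_of_le_of_le tendsto_const_nhds hlim (fun _ => zero_le) hbound

/-- **The `L²` limit is locally integrable** (indeed locally square integrable): on each
cylinder `Q_n` it is the `L²` limit of fields which are in `L²(Q_n)`. [folklore] -/
theorem locallyIntegrable_of_cylinder_limit {V : ℕ → ℝ → EuclideanSpace ℝ (Fin 3) → EuclideanSpace ℝ (Fin 3)}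
    {u : ℝ → EuclideanSpace ℝ (Fin 3) → EuclideanSpace ℝ (Fin 3)}
    (hVm : ∀ k, AEStronglyMeasurable (uncurry (V k)) (volume : Measure (ℝ × EuclideanSpace ℝ (Fin 3))))
    (hV2 : ∀ k (n : ℕ), ∫⁻ z in Ioo (-((n : ℝ) + 1)) ((n : ℝ) + 1) ×ˢ
        ball (0 : EuclideanSpace ℝ (Fin 3)) (n + 1), ‖V k z.1 z.2‖ₑ ^ 2 < ∞)
    (hum : AEStronglyMeasurable (uncurry u) (volume : Measure (ℝ × EuclideanSpace ℝ (Fin 3))))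
    (hconv : ∀ n : ℕ, Tendsto (fun k => ∫⁻ z in Ioo (-((n : ℝ) + 1)) ((n : ℝ) + 1) ×ˢ
        ball (0 : EuclideanSpace ℝ (Fin 3)) (n + 1), ‖V k z.1 z.2 - u z.1 z.2‖ₑ ^ 2) atTop (𝓝 0)) :
    (∀ n : ℕ, ∫⁻ z in Ioo (-((n : ℝ) + 1)) ((n : ℝ) + 1) ×ˢ ball (0 : EuclideanSpace ℝ (Fin 3)) (n + 1),
      ‖u z.1 z.2‖ₑ ^ 2 < ∞) ∧
    LocallyIntegrable (uncurry u) (volume : Measure (ℝ × EuclideanSpace ℝ (Fin 3))) := by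
  have hu2 : ∀ n : ℕ, ∫⁻ z in Ioo (-((n : ℝ) + 1)) ((n : ℝ) + 1) ×ˢ ball (0 : EuclideanSpace ℝ (Fin 3)) (n + 1),
      ‖u z.1 z.2‖ₑ ^ 2 < ∞ := by
    intro n
    set Q : Set (ℝ × EuclideanSpace ℝ (Fin 3)) :=
      Ioo (-((n : ℝ) + 1)) ((n : ℝ) + 1) ×ˢ ball (0 : EuclideanSpace ℝ (Fin 3)) (n + 1) with hQ
    obtain ⟨k, hk⟩ := (((hconv n).eventually (gt_mem_nhds (show (0 : ℝ≥0∞) < 1 by norm_num))).exists)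
    calc ∫⁻ z in Q, ‖u z.1 z.2‖ₑ ^ 2
        ≤ ∫⁻ z in Q, (2 * ‖V k z.1 z.2 - u z.1 z.2‖ₑ ^ 2 + 2 * ‖V k z.1 z.2‖ₑ ^ 2) := by
          refine lintegral_mono fun z => ?_
          have h := FunctionSpaces.AubinLions.enorm_sub_sq_le (V k z.1 z.2) (V k z.1 z.2 - u z.1 z.2)
          rw [sub_sub_cancel] at h
          calc ‖u z.1 z.2‖ₑ ^ 2 ≤ 2 * (‖V k z.1 z.2‖ₑ ^ 2 + ‖V k z.1 z.2 - u z.1 z.2‖ₑ ^ 2) := h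
            _ = 2 * ‖V k z.1 z.2 - u z.1 z.2‖ₑ ^ 2 + 2 * ‖V k z.1 z.2‖ₑ ^ 2 := by ring
      _ = (2 * ∫⁻ z in Q, ‖V k z.1 z.2 - u z.1 z.2‖ₑ ^ 2) + 2 * ∫⁻ z in Q, ‖V k z.1 z.2‖ₑ ^ 2 := by
          have hm1 : AEMeasurable (fun z : ℝ × EuclideanSpace ℝ (Fin 3) => 2 * ‖V k z.1 z.2 - u z.1 z.2‖ₑ ^ 2)
              (volume.restrict Q) :=
            ((((hVm k).sub hum).restrict).enorm.pow_const 2).const_mul 2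
          rw [lintegral_add_left' hm1, lintegral_const_mul' _ _ ENNReal.ofNat_ne_top,
            lintegral_const_mul' _ _ ENNReal.ofNat_ne_top]
      _ < ∞ := ENNReal.add_lt_top.2 ⟨ENNReal.mul_lt_top ENNReal.ofNat_lt_top (hk.trans ENNReal.one_lt_top),
          ENNReal.mul_lt_top ENNReal.ofNat_lt_top (hV2 k n)⟩
  refine ⟨hu2, fun z => ?_⟩
  -- every point has a cylinder as a neighbourhood
  obtain ⟨n, hn⟩ := exists_subset_cylinder_of_isCompact (isCompact_singleton (x := z))
  set Q : Set (ℝ × EuclideanSpace ℝ (Fin 3)) :=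
    Ioo (-((n : ℝ) + 1)) ((n : ℝ) + 1) ×ˢ ball (0 : EuclideanSpace ℝ (Fin 3)) (n + 1) with hQ
  have hzQ : z ∈ Q := hn (mem_singleton z)
  have hQo : IsOpen Q := isOpen_Ioo.prod isOpen_ball
  refine ⟨Q, hQo.mem_nhds hzQ, ?_⟩
  haveI : IsFiniteMeasure (volume.restrict Q) :=
    NSCylinder.isFiniteMeasure_restrict (Ω := ⟨ball (0 : EuclideanSpace ℝ (Fin 3)) (n + 1), isOpen_ball⟩)
      isBounded_ball _ _
  have hmem : MemLp (uncurry u) 2 (volume.restrict Q) := by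
    refine ⟨hum.restrict, ?_⟩
    rw [FunctionSpaces.AubinLions.eLpNorm_two_eq_rpow]
    exact ENNReal.rpow_lt_top_of_nonneg (by norm_num) (hu2 n).ne
  exact hmem.integrable one_le_two

end Compact

/-! ### The weak gradient of the limit and the weak convergence of the gradients -/

section Gradient

variable {T : ℝ} {C : ℝ≥0}

/-- **The gradient part of the limit `ε → 0`: one further subsequence, one weak spatial gradient
of the limit on `ℝ × ℝ³`, weak `L²` convergence on every time slab** ([BT1], proof of Thm 2.4:
"`U_{ε_k} → U` weakly in `L²(0,T;X)`"; Brezis 2011, Thm. 3.18). Let `U_k` be `T`-periodic fields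
with weak spatial gradients `G_k` on `ℝ × ℝ³`, `∫∫_{(0,T)×ℝ³} |G_k|² ≤ C`, square integrable on
the cylinders `Q_n`, and let `U_{φ k} → u` in `L²(Q_n)` for every `n` (`u` jointly measurable).
Then along a further subsequence `κ`, `u` has a weak spatial gradient `G` on `ℝ × ℝ³` with
`∫∫_{(−m−1,m+1)×ℝ³} |G|² ≤ 2(⌈(2m+2)/T⌉₊ + 1) C` for every `m`, and
`∫_{Ω_m} ⟪G_{φ(κ k)} a, h⟫ → ∫_{Ω_m} ⟪G a, h⟫` for every slab `Ω_m = (−m−1, m+1) × ℝ³`, direction `a`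
and `h ∈ L²(Ω_m; ℝ³)`. [cite: BradshawTsai2017AHP, proof of Thm 2.4 ("U_{ε_k} → U weakly in L²(0,T;X)")] -/
theorem exists_gradient_limit (hT : 0 < T)
    {U : ℕ → ℝ → EuclideanSpace ℝ (Fin 3) → EuclideanSpace ℝ (Fin 3)}
    {G : ℕ → ℝ → EuclideanSpace ℝ (Fin 3) → EuclideanSpace ℝ (Fin 3) →L[ℝ] EuclideanSpace ℝ (Fin 3)}
    (hper : ∀ k s y, U k (s + T) y = U k s y)
    (hG : ∀ k, HasWeakSpatialGradientOn (⊤ : Opens (ℝ × EuclideanSpace ℝ (Fin 3))) (U k) (G k))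
    (hGb : ∀ k, ∫⁻ z in Ioo 0 T ×ˢ (univ : Set (EuclideanSpace ℝ (Fin 3))),
      ENNReal.ofReal (frobeniusNormSq (G k z.1 z.2)) ≤ C)
    (hU2 : ∀ k (n : ℕ), ∫⁻ z in Ioo (-((n : ℝ) + 1)) ((n : ℝ) + 1) ×ˢ
        ball (0 : EuclideanSpace ℝ (Fin 3)) (n + 1), ‖U k z.1 z.2‖ₑ ^ 2 < ∞)
    {φ : ℕ → ℕ} {u : ℝ → EuclideanSpace ℝ (Fin 3) → EuclideanSpace ℝ (Fin 3)}
    (hum : AEStronglyMeasurable (uncurry u) (volume : Measure (ℝ × EuclideanSpace ℝ (Fin 3))))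
    (hconv : ∀ n : ℕ, Tendsto (fun k => ∫⁻ z in Ioo (-((n : ℝ) + 1)) ((n : ℝ) + 1) ×ˢ
        ball (0 : EuclideanSpace ℝ (Fin 3)) (n + 1), ‖U (φ k) z.1 z.2 - u z.1 z.2‖ₑ ^ 2) atTop (𝓝 0)) :
    ∃ (κ : ℕ → ℕ) (Gu : ℝ → EuclideanSpace ℝ (Fin 3) → EuclideanSpace ℝ (Fin 3) →L[ℝ] EuclideanSpace ℝ (Fin 3)),
      StrictMono κ ∧
      HasWeakSpatialGradientOn (⊤ : Opens (ℝ × EuclideanSpace ℝ (Fin 3))) u Gu ∧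
      (∀ m : ℕ, ∫⁻ z in Ioo (-((m : ℝ) + 1)) ((m : ℝ) + 1) ×ˢ (univ : Set (EuclideanSpace ℝ (Fin 3))),
        ENNReal.ofReal (frobeniusNormSq (Gu z.1 z.2)) ≤
          2 * (⌈(((m : ℝ) + 1) - (-((m : ℝ) + 1))) / T⌉₊ + 1 : ℕ) * C) ∧
      ∀ (m : ℕ) (a : EuclideanSpace ℝ (Fin 3)) (h : ℝ × EuclideanSpace ℝ (Fin 3) → EuclideanSpace ℝ (Fin 3)),
        MemLp h 2 (volume.restrict (Ioo (-((m : ℝ) + 1)) ((m : ℝ) + 1) ×ˢ (univ : Set (EuclideanSpace ℝ (Fin 3))))) →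
        Tendsto (fun k => ∫ z in Ioo (-((m : ℝ) + 1)) ((m : ℝ) + 1) ×ˢ (univ : Set (EuclideanSpace ℝ (Fin 3))),
            ⟪G (φ (κ k)) z.1 z.2 a, h z⟫) atTop
          (𝓝 (∫ z in Ioo (-((m : ℝ) + 1)) ((m : ℝ) + 1) ×ˢ (univ : Set (EuclideanSpace ℝ (Fin 3))),
            ⟪Gu z.1 z.2 a, h z⟫)) := by
  -- the slabs `Ω m = (−m−1, m+1) × ℝ³`
  set Ω : ℕ → Opens (ℝ × EuclideanSpace ℝ (Fin 3)) := fun m =>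
    ⟨Ioo (-((m : ℝ) + 1)) ((m : ℝ) + 1) ×ˢ (univ : Set (EuclideanSpace ℝ (Fin 3))),
      isOpen_Ioo.prod isOpen_univ⟩ with hΩ
  have hΩcoe : ∀ m, ((Ω m : Opens (ℝ × EuclideanSpace ℝ (Fin 3))) : Set (ℝ × EuclideanSpace ℝ (Fin 3))) =
      Ioo (-((m : ℝ) + 1)) ((m : ℝ) + 1) ×ˢ (univ : Set (EuclideanSpace ℝ (Fin 3))) := fun m => rfl
  have hΩmono : Monotone Ω := fun m m' hmm' z hz => by
    have : (m : ℝ) ≤ m' := Nat.cast_le.2 hmm'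
    exact ⟨⟨by linarith [hz.1.1], by linarith [hz.1.2]⟩, mem_univ _⟩
  -- the gradient bounds on the slabs
  set L : ℕ → ℝ≥0∞ := fun m => 2 * (⌈(((m : ℝ) + 1) - (-((m : ℝ) + 1))) / T⌉₊ + 1 : ℕ) * (C : ℝ≥0∞) with hL
  have hLtop : ∀ m, L m ≠ ∞ := fun m =>
    ENNReal.mul_ne_top (ENNReal.mul_ne_top ENNReal.ofNat_ne_top (ENNReal.natCast_ne_top _)) ENNReal.coe_ne_top
  have hGbm : ∀ k m, ∫⁻ z in (Ω m : Set (ℝ × EuclideanSpace ℝ (Fin 3))),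
      ENNReal.ofReal (frobeniusNormSq (G k z.1 z.2)) ≤ L m := fun k m =>
    lintegral_window_gradient_le (hG k) hT (hper k) (hGb k) _ _
  -- local integrability of the limit and `L¹` convergence on compact sets
  have hVm : ∀ k, AEStronglyMeasurable (uncurry (U k)) (volume : Measure (ℝ × EuclideanSpace ℝ (Fin 3))) := by
    intro k
    have h1 := (hG k).locallyIntegrableOn.aestronglyMeasurable
    rwa [Opens.coe_top, Measure.restrict_univ] at h1
  obtain ⟨-, huloc⟩ := locallyIntegrable_of_cylinder_limit (V := fun k => U (φ k)) (fun k => hVm (φ k))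
    (fun k n => hU2 (φ k) n) hum hconv
  have hL1 : ∀ {K : Set (ℝ × EuclideanSpace ℝ (Fin 3))}, IsCompact K →
      Tendsto (fun k => eLpNorm (fun z => uncurry (U (φ k)) z - uncurry u z) 1 (volume.restrict K))
        atTop (𝓝 0) := fun {K} hK =>
    tendsto_eLpNorm_one_of_isCompact (V := fun k => U (φ k)) (fun k => hVm (φ k)) hum hconv hK
  -- the extraction property on `Ω m`
  let P : ℕ → (ℕ → ℕ) → Prop := fun m κ =>
    ∃ Gm : ℝ → EuclideanSpace ℝ (Fin 3) → EuclideanSpace ℝ (Fin 3) →L[ℝ] EuclideanSpace ℝ (Fin 3),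
      HasWeakSpatialGradientOn (Ω m) u Gm ∧
      (∫⁻ z in (Ω m : Set (ℝ × EuclideanSpace ℝ (Fin 3))), ENNReal.ofReal (frobeniusNormSq (Gm z.1 z.2)) ≤ L m) ∧
      ∀ (a : EuclideanSpace ℝ (Fin 3)) (h : ℝ × EuclideanSpace ℝ (Fin 3) → EuclideanSpace ℝ (Fin 3)),
        MemLp h 2 (volume.restrict (Ω m : Set (ℝ × EuclideanSpace ℝ (Fin 3)))) →
        Tendsto (fun k => ∫ z in (Ω m : Set (ℝ × EuclideanSpace ℝ (Fin 3))), ⟪G (φ (κ k)) z.1 z.2 a, h z⟫) atTop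
          (𝓝 (∫ z in (Ω m : Set (ℝ × EuclideanSpace ℝ (Fin 3))), ⟪Gm z.1 z.2 a, h z⟫))
  have hsub : ∀ m (κ κ' : ℕ → ℕ), (∃ ρ : ℕ → ℕ, StrictMono ρ ∧ ∀ᶠ k in atTop, κ' k = κ (ρ k)) →
      P m κ → P m κ' := by
    rintro m κ κ' ⟨ρ, hρ, heq⟩ ⟨Gm, hGm, hGmb, hGmw⟩
    refine ⟨Gm, hGm, hGmb, fun a h hh => ?_⟩
    exact FunctionSpaces.tendsto_of_eventually_eq_comp
      (a := fun j => ∫ z in (Ω m : Set (ℝ × EuclideanSpace ℝ (Fin 3))), ⟪G (φ j) z.1 z.2 a, h z⟫) hρ heq (hGmw a h hh)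
  have hex : ∀ m (κ : ℕ → ℕ), StrictMono κ → ∃ ψ : ℕ → ℕ, StrictMono ψ ∧ P m (κ ∘ ψ) := by
    intro m κ hκ
    obtain ⟨Gm, ψ, hψ, hGm, -, hGmb, hGmw, -, -⟩ :=
      exists_hasWeakSpatialGradientOn_of_weakGradient_approx_L2 (Ω := Ω m) (u := u)
        (huloc.locallyIntegrableOn _) (V := fun k => U (φ (κ k))) (Gn := fun k => G (φ (κ k)))
        (fun k => (hG _).mono le_top)
        (fun K _ hK => (hL1 hK).comp hκ.tendsto_atTop) (hLtop m) (fun k => hGbm _ m)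
    exact ⟨ψ, hψ, Gm, hGm, hGmb, hGmw⟩
  obtain ⟨κ, hκ, hP⟩ := FunctionSpaces.exists_strictMono_forall_of_extraction hsub hex
  choose Gm hGm hGmb hGmw using hP
  -- glue the gradients along the exhaustion by slabs
  have hcov : ∀ K ⊆ ((⊤ : Opens (ℝ × EuclideanSpace ℝ (Fin 3))) : Set (ℝ × EuclideanSpace ℝ (Fin 3))),
      IsCompact K → ∃ m, K ⊆ (Ω m : Set (ℝ × EuclideanSpace ℝ (Fin 3))) := by
    intro K _ hK
    obtain ⟨m, hm⟩ := exists_subset_cylinder_of_isCompact hK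
    exact ⟨m, fun z hz => ⟨(hm hz).1, mem_univ _⟩⟩
  obtain ⟨Gu, hGu, hGuae⟩ := exists_hasWeakSpatialGradientOn_of_exhaustion
    (Q := (⊤ : Opens (ℝ × EuclideanSpace ℝ (Fin 3)))) hΩmono hcov hGm
  have hGuae' : ∀ m, ∀ᵐ z ∂(volume.restrict (Ω m : Set (ℝ × EuclideanSpace ℝ (Fin 3)))),
      uncurry Gu z = uncurry (Gm m) z := fun m =>
    (ae_restrict_iff' (Ω m).isOpen.measurableSet).2 (hGuae m)
  refine ⟨κ, Gu, hκ, hGu, fun m => ?_, fun m a h hh => ?_⟩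
  · -- the slab bounds pass to the glued gradient
    calc ∫⁻ z in Ioo (-((m : ℝ) + 1)) ((m : ℝ) + 1) ×ˢ (univ : Set (EuclideanSpace ℝ (Fin 3))),
          ENNReal.ofReal (frobeniusNormSq (Gu z.1 z.2))
        = ∫⁻ z in (Ω m : Set (ℝ × EuclideanSpace ℝ (Fin 3))), ENNReal.ofReal (frobeniusNormSq (Gm m z.1 z.2)) := by
          refine lintegral_congr_ae ?_
          filter_upwards [hGuae' m] with z hz
          change ENNReal.ofReal (frobeniusNormSq (uncurry Gu z)) = ENNReal.ofReal (frobeniusNormSq (uncurry (Gm m) z))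
          rw [hz]
      _ ≤ L m := hGmb m
  · -- the weak convergence, with the glued gradient as the limit
    have e : ∫ z in Ioo (-((m : ℝ) + 1)) ((m : ℝ) + 1) ×ˢ (univ : Set (EuclideanSpace ℝ (Fin 3))), ⟪Gu z.1 z.2 a, h z⟫ =
        ∫ z in (Ω m : Set (ℝ × EuclideanSpace ℝ (Fin 3))), ⟪Gm m z.1 z.2 a, h z⟫ := by
      refine integral_congr_ae ?_
      filter_upwards [hGuae' m] with z hz
      change ⟪uncurry Gu z a, h z⟫ = ⟪uncurry (Gm m) z a, h z⟫
      rw [hz]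
    rw [e]
    exact hGmw m a h hh

end Gradient

end BradshawTsai2017

end Literature.Analysis.FluidPDE

end
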